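import Literature.Geometry.Lorentzian.KerrInteriorCylinder
import Literature.Geometry.Lorentzian.KerrRicciFlat
import Literature.Geometry.Lorentzian.InducedVacuumData
import Literature.Geometry.Lorentzian.InitialDataLocality
import Literature.Geometry.Lorentzian.KerrSchildCoord
import HarnessLib

/-!
# Exact Kerr-cylinder data are vacuum: `IsKerrCylinderOn` on an open set implies `IsVacuumOn`
# there (the "Kerrian end" of the conclusion of Li–Mei 2020, Prop. 4.1, solves the constraints)

Support file (all results proved; no named facts) for the named fact `LiMei.interiorKerrGluing`
(`InteriorKerrGluing.lean`; J. Li, H. Mei, *A construction of collapsing spacetimes in vacuum*,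
Comm. Math. Phys. 378 (2020) = arXiv:2005.01249, Prop. 4.1). The conclusion of the fact asserts
BOTH that the glued datum `D'` is exactly the Kerr(`m, a`)-cylinder datum on the outer sub-annulus
`s = {σ₂ < ‖y‖ < ρ₂}` (`LiMei.IsKerrCylinderOn m a r₀ τ₀ R s D'`) AND that it solves the vacuum
constraints on the whole annulus (`LiMei.IsVacuumOn`); in the printed proof the second is automatic
on the Kerrian end — "(g̃, π̃) = (ḡ_{m,a}, π̄_{m,a}) near `t = t₂`", and Kerr data solve
`Φ(ḡ, π̄) = 0` because Kerr is a vacuum spacetime (arXiv p. 22: the deformation is only needed where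
the cut-off interpolates). This file proves that implication in the tree's vocabulary, for every
spin: **`LiMei.isVacuumOn_of_isKerrCylinderOn`** — if `D` is exactly the Kerr(`m, a`)-cylinder
datum on an OPEN set `s ⊆ {1 < ‖y‖}` (`|a| < m`, `r₋ < r₀ < r₊`), then `D` solves the vacuum
constraint equations at every point of `s`.

Proof (Gauss–Codazzi, as for the Kerr–Schild slices in `KerrDataConstraints.lean`): restrict `D` to
the open submanifold `s` (`InitialDataSet.comap` along the inclusion, whose constraint functions
are those of `D`, `hamiltonianConstraintFn_comap` / `momentumConstraintFn_comap_apply` of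
`InitialDataPullback.lean`), read the restricted datum as the one induced by the spacelike immersion
`y ↦ kerrCylMap r₀ a τ₀ R y` of `s` into the Ricci-flat (`Kerr.ricci_smoothMetric`) Kerr chart with
its future unit normal `ν = (−g^{rr})^{-1/2} g♯dr` (`KerrInteriorCylinder.lean`; the abstract normal
of `IsKerrCylinderOn` IS this one by uniqueness, and the second fundamental forms of the frame on
`Kerr.slice 0 1` and of its restriction to `s` agree through the coordinate formula
`OpensChart.secondFundamentalForm_eq_of_repr`), and apply the twice-traced Gauss and traced Codazzi
equations (`InitialDataSet.isVacuumConstraintSolution_of_eq_induced`, Choquet-Bruhat 2009, Ch. VI,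
Thm. 3.3). The smoothness of the lift of `ν` needed there is that of the explicit representative
(`LiMei.contDiffAt_kerrCylUnitNormal`: `∇r`, `Σ`, `H`, `ℓ♯` are smooth off the disc and `Δ/Σ < 0`).

Also recorded: the frame facts of `KerrInteriorCylinder.lean` for an ARBITRARY open domain
`U ⊆ {y ≠ 0}` (`isSpacelikeImmersion_kerrCylOn`, `isUnitNormal_kerrCylUnitNormalOn`,
`contMDiff_kerrCylUnitNormal_lift`), of which the `Kerr.slice 0 1` versions are the special case.

## References

* J. Li, H. Mei, *A construction of collapsing spacetimes in vacuum*, Comm. Math. Phys. 378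
  (2020), arXiv:2005.01249, §4, p. 22 and Prop. 4.1 (key `LiMei2020`).
* Y. Choquet-Bruhat, *General Relativity and the Einstein Equations* (2009), Ch. VI, Thm. 3.3
  (key `ChoquetBruhat2009`).
* R. Bartnik, J. Isenberg, *The constraint equations* (2004), §2 (local character, diffeomorphism
  equivariance) (key `BartnikIsenberg2004`).
* R. P. Kerr, A. Schild (1965), §3 (Ricci-flatness) (key `KerrSchild1965`).
-/

noncomputable section

open Bundle Set TopologicalSpace Manifold Module Filter Function
open scoped Manifold ContDiff Topology RealInnerProductSpace

namespace Literature.Geometry.Lorentzian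

namespace Kerr

/-! ### Smoothness of `∇r`, `g♯dr` and `g(g♯dr, g♯dr)` off the disc -/

/-- `Σ(y) = 2r² − ‖y‖² + a²` is `C^n` wherever `r > 0`. [folklore] -/
theorem contDiffAt_blSigma {a : ℝ} {y : E3} (hr : 0 < radius a (E4.ofTimeSpace 0 y))
    {n : WithTop ℕ∞} : ContDiffAt ℝ n (blSigma a) y := by
  unfold blSigma
  exact ((contDiffAt_const.mul ((contDiffAt_radius_slice hr).pow 2)).sub
    (contDiff_norm_sq ℝ).contDiffAt).add contDiffAt_const

/-- **The gradient `∇r = (r² y + a² z e_z)/(rΣ)` is `C^n` wherever `r > 0`.** [folklore] -/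
theorem contDiffAt_radiusGradVec {a : ℝ} {y : E3} (hr : 0 < radius a (E4.ofTimeSpace 0 y))
    {n : WithTop ℕ∞} : ContDiffAt ℝ n (radiusGradVec a) y := by
  have hR := contDiffAt_radius_slice hr (n := n)
  have hS := contDiffAt_blSigma hr (n := n)
  have hne : radius a (E4.ofTimeSpace 0 y) * blSigma a y ≠ 0 :=
    mul_ne_zero hr.ne' (blSigma_pos hr).ne'
  have h2 : ContDiff ℝ n (fun y : E3 ↦ y 2) := (EuclideanSpace.proj (𝕜 := ℝ) (2 : Fin 3)).contDiff
  unfold radiusGradVec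
  exact ((hR.mul hS).inv hne).smul
    (((hR.pow 2).smul contDiffAt_id).add ((contDiffAt_const.mul h2.contDiffAt).smul contDiffAt_const))

/-- **`g♯dr = (0, ∇r) − 2H ℓ♯` is `C^n` wherever `r > 0`.** [folklore] -/
theorem contDiffAt_radiusSharp (M : ℝ) {a : ℝ} {x : E4} (hx : 0 < radius a x) {n : WithTop ℕ∞} :
    ContDiffAt ℝ n (radiusSharp M a) x := by
  have hr : 0 < radius a (E4.ofTimeSpace 0 (E4.spatial x)) := by rwa [radius_ofTimeSpace_spatial]
  have h1 : ContDiffAt ℝ n (fun x : E4 ↦ radiusGradVec a (E4.spatial x)) x :=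
    (contDiffAt_radiusGradVec hr).comp x E4.spatial.contDiff.contDiffAt
  unfold radiusSharp
  exact (E4.spaceEmbed.contDiff.contDiffAt.comp x h1).sub
    ((contDiffAt_const.mul (contDiffAt_scalarH M a hx)).smul (contDiffAt_nullVector a hx))

/-- `x ↦ g_x(g♯dr, g♯dr)` is `C^n` wherever `r > 0`. [folklore] -/
theorem contDiffAt_bilin_radiusSharp_self (M : ℝ) {a : ℝ} {x : E4} (hx : 0 < radius a x)
    {n : WithTop ℕ∞} :
    ContDiffAt ℝ n (fun x : E4 ↦ bilin M a x (radiusSharp M a x) (radiusSharp M a x)) x :=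
  ((contDiffAt_bilin M a hx).clm_apply (contDiffAt_radiusSharp M hx)).clm_apply
    (contDiffAt_radiusSharp M hx)

end Kerr

namespace LiMei

/-- **The unit normal `ν = (−g(g♯dr, g♯dr))^{-1/2} g♯dr` is `C^n` at every point with `r > 0` and
`g(g♯dr, g♯dr) < 0`** (between the horizons). [folklore] -/
theorem contDiffAt_kerrCylUnitNormal {m a : ℝ} {x : E4} (hx : 0 < Kerr.radius a x)
    (hq : Kerr.bilin m a x (Kerr.radiusSharp m a x) (Kerr.radiusSharp m a x) < 0)
    {n : WithTop ℕ∞} : ContDiffAt ℝ n (kerrCylUnitNormal m a) x := by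
  have h1 := (Kerr.contDiffAt_bilin_radiusSharp_self m hx (n := n)).neg
  have hpos : 0 < -Kerr.bilin m a x (Kerr.radiusSharp m a x) (Kerr.radiusSharp m a x) := by linarith
  have h2 := (h1.sqrt hpos.ne').inv (Real.sqrt_pos.2 hpos).ne'
  unfold kerrCylUnitNormal
  exact h2.smul (Kerr.contDiffAt_radiusSharp m hx)

/-! ### The Kerr cylinder frame on an arbitrary open domain `U ⊆ {y ≠ 0}` -/

section Frame

variable {m a r₁ r₀ τ₀ : ℝ} {R : E3 →ₗᵢ[ℝ] E3} {U : Opens E3} {f : U → Kerr.region a r₁}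

/-- A map `f : U → Kerr.region a r₁` with `(f y : E4) = kerrCylMap r₀ a τ₀ R y` on an open
`U ⊆ {y ≠ 0}` is `C^n` for every `n`. [folklore] -/
theorem contMDiff_kerrCylOn (hU : ∀ y : U, (y : E3) ≠ 0)
    (hf : ∀ y, (f y : E4) = kerrCylMap r₀ a τ₀ R (y : E3)) (n : ℕ∞ω) :
    ContMDiff 𝓘(ℝ, E3) 𝓘(ℝ, E4) n f := fun y ↦
  (ChartedSpace.liftPropWithinAt_subtypeVal_comp_iff f Set.univ y).mp
    ((OpensChart.contMDiffAt_iff y (Subtype.val ∘ f) (kerrCylMap r₀ a τ₀ R) (fun z ↦ hf z)).2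
      (contDiffAt_kerrCylMap r₀ a τ₀ R (hU y)))

/-- The differential of such a map is `kerrCylDeriv`. [folklore] -/
theorem mfderiv_kerrCylOn_apply (hU : ∀ y : U, (y : E3) ≠ 0)
    (hf : ∀ y, (f y : E4) = kerrCylMap r₀ a τ₀ R (y : E3)) (y : U) (v : E3) :
    mfderiv 𝓘(ℝ, E3) 𝓘(ℝ, E4) f y v = kerrCylDeriv r₀ a R (y : E3) v := by
  rw [OpensChart.mfderiv_apply_of_repr hf (differentiableAt_kerrCylMap r₀ a τ₀ R (hU y)),
    fderiv_kerrCylMap r₀ a τ₀ R (hU y)]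

/-- At a point of such a frame, `r > 0` and `g(g♯dr, g♯dr) = Δ(r₀)/Σ < 0` (`|a| < m`,
`r₋ < r₀ < r₊`). [cite: ONeill1995, Ch. 2, §2.5] -/
theorem radius_pos_and_bilin_radiusSharp_neg (ha : |a| < m) (h₁ : Kerr.rMinus m a < r₀)
    (h₂ : r₀ < Kerr.rPlus m a) (hU : ∀ y : U, (y : E3) ≠ 0)
    (hf : ∀ y, (f y : E4) = kerrCylMap r₀ a τ₀ R (y : E3)) (y : U) :
    0 < Kerr.radius a (f y : E4) ∧
      Kerr.bilin m a (f y : E4) (Kerr.radiusSharp m a (f y : E4)) (Kerr.radiusSharp m a (f y : E4))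
        < 0 := by
  have hr₀ : 0 < r₀ := (Kerr.IsSubextremal.rMinus_nonneg ha).trans_lt h₁
  have hx : 0 < Kerr.radius a (f y : E4) := by
    rw [hf y, radius_kerrCylMap hr₀.le a τ₀ R (hU y)]; exact hr₀
  refine ⟨hx, ?_⟩
  rw [Kerr.bilin_radiusSharp_self m hx, hf y, radius_kerrCylMap hr₀.le a τ₀ R (hU y)]
  exact div_neg_of_neg_of_pos (Kerr.delta_neg ha.le h₁ h₂)
    (Kerr.blSigma_spatial_pos (by rw [radius_kerrCylMap hr₀.le a τ₀ R (hU y)]; exact hr₀))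

/-- **The Kerr cylinder frame on any open `U ⊆ {y ≠ 0}` is a smooth spacelike immersion**
(`|a| < m`, `r₋ < r₀ < r₊`); `isSpacelikeImmersion_kerrCyl` is the case `U = Kerr.slice 0 1`.
Li–Mei arXiv:2005.01249, §4, p. 22. [cite: LiMei2020, §4] -/
theorem isSpacelikeImmersion_kerrCylOn [Kerr.Facts] (ha : |a| < m) (h₁ : Kerr.rMinus m a < r₀)
    (h₂ : r₀ < Kerr.rPlus m a) (hU : ∀ y : U, (y : E3) ≠ 0)
    (hf : ∀ y, (f y : E4) = kerrCylMap r₀ a τ₀ R (y : E3)) :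
    (Kerr.smoothMetric m a r₁).IsSpacelikeImmersion 𝓘(ℝ, E3) f := by
  have hr₀ : 0 < r₀ := (Kerr.IsSubextremal.rMinus_nonneg ha).trans_lt h₁
  refine ⟨contMDiff_kerrCylOn hU hf _, fun y v hv ↦ ?_⟩
  obtain ⟨hx, hnn⟩ := radius_pos_and_bilin_radiusSharp_neg ha h₁ h₂ hU hf y
  rw [PseudoRiemannianMetric.inducedBilin_apply, mfderiv_kerrCylOn_apply hU hf, Kerr.smoothMetric_val]
  have hnw : Kerr.bilin m a (f y : E4) (Kerr.radiusSharp m a (f y : E4))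
      (kerrCylDeriv r₀ a R (y : E3) v) = 0 := by
    rw [Kerr.bilin_radiusSharp m hx, hf y]
    exact inner_radiusGradVec_kerrCylDeriv hr₀ a τ₀ R (hU y) v
  have hw : kerrCylDeriv r₀ a R (y : E3) v ≠ 0 := fun h ↦
    hv ((kerrCylDeriv_injective hr₀ a R (hU y)) (h.trans (map_zero _).symm))
  exact Kerr.bilin_pos_of_orthogonal m a hx _ _ hnn hnw hw

/-- **On any open `U ⊆ {y ≠ 0}`, `y ↦ kerrCylUnitNormal m a (f y)` is a unit normal of sign `−1`
along the Kerr cylinder frame** (`|a| < m`, `r₋ < r₀ < r₊`). [cite: LiMei2020, §4] -/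
theorem isUnitNormal_kerrCylUnitNormalOn [Kerr.Facts] (ha : |a| < m) (h₁ : Kerr.rMinus m a < r₀)
    (h₂ : r₀ < Kerr.rPlus m a) (hU : ∀ y : U, (y : E3) ≠ 0)
    (hf : ∀ y, (f y : E4) = kerrCylMap r₀ a τ₀ R (y : E3)) :
    (Kerr.smoothMetric m a r₁).IsUnitNormal 𝓘(ℝ, E3) f
      (fun y ↦ kerrCylUnitNormal m a (f y : E4)) (-1) := by
  have hr₀ : 0 < r₀ := (Kerr.IsSubextremal.rMinus_nonneg ha).trans_lt h₁
  refine ⟨fun y v ↦ ?_, fun y ↦ ?_⟩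
  · -- normal
    obtain ⟨hx, _⟩ := radius_pos_and_bilin_radiusSharp_neg ha h₁ h₂ hU hf y
    rw [mfderiv_kerrCylOn_apply hU hf, Kerr.smoothMetric_val]
    show Kerr.bilin m a (f y : E4) (kerrCylUnitNormal m a (f y : E4))
      (kerrCylDeriv r₀ a R (y : E3) v) = 0
    rw [kerrCylUnitNormal, map_smul, smul_apply, smul_eq_mul]
    refine mul_eq_zero_of_right _ ?_
    have h := inner_radiusGradVec_kerrCylDeriv hr₀ a τ₀ R (hU y) v
    rw [← hf y] at h
    rw [Kerr.bilin_radiusSharp m hx]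
    exact h
  · -- unit
    obtain ⟨_, hq⟩ := radius_pos_and_bilin_radiusSharp_neg ha h₁ h₂ hU hf y
    set q := Kerr.bilin m a (f y : E4) (Kerr.radiusSharp m a (f y : E4))
      (Kerr.radiusSharp m a (f y : E4)) with hq_def
    have hs : √(-q) ^ 2 = -q := Real.sq_sqrt (by linarith)
    rw [Kerr.smoothMetric_val]
    show Kerr.bilin m a (f y : E4) (kerrCylUnitNormal m a (f y : E4))
      (kerrCylUnitNormal m a (f y : E4)) = -1
    rw [kerrCylUnitNormal, map_smul, map_smul, smul_apply, smul_eq_mul, smul_eq_mul, ← hq_def]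
    have hc2 : (√(-q))⁻¹ * (√(-q))⁻¹ = (-q)⁻¹ := by rw [← mul_inv, ← sq, hs]
    rw [← mul_assoc, hc2, inv_mul_eq_div, div_neg_eq_neg_div, div_self hq.ne]

/-- **The unit normal of the Kerr cylinder frame has a `C^∞` lift** along `f` on any open
`U ⊆ {y ≠ 0}`: in the identity trivialisation of `T(Kerr.region a r₁)` this is the smoothness of
`f` and of the representative `kerrCylUnitNormal m a ∘ kerrCylMap r₀ a τ₀ R`
(`contDiffAt_kerrCylUnitNormal`, `contDiffAt_kerrCylMap`). This is the regularity hypothesis of the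
Gauss–Codazzi equations (`InitialDataSet.isVacuumConstraintSolution_of_eq_induced`). [folklore] -/
theorem contMDiff_kerrCylUnitNormal_lift (ha : |a| < m) (h₁ : Kerr.rMinus m a < r₀)
    (h₂ : r₀ < Kerr.rPlus m a) (hU : ∀ y : U, (y : E3) ≠ 0)
    (hf : ∀ y, (f y : E4) = kerrCylMap r₀ a τ₀ R (y : E3)) :
    ContMDiff 𝓘(ℝ, E3) 𝓘(ℝ, E4).tangent ∞
      (fun y : U ↦ (TotalSpace.mk' E4 (f y) (kerrCylUnitNormal m a (f y : E4)) :
        TangentBundle 𝓘(ℝ, E4) (Kerr.region a r₁))) := by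
  intro y
  rw [ModelWithCorners.tangent, contMDiffAt_totalSpace]
  refine ⟨contMDiff_kerrCylOn hU hf ∞ y, ?_⟩
  have h : (fun x : U ↦ (trivializationAt E4 (TangentSpace 𝓘(ℝ, E4)) (f y)
      (TotalSpace.mk' E4 (f x) (kerrCylUnitNormal m a (f x : E4)) :
        TangentBundle 𝓘(ℝ, E4) (Kerr.region a r₁))).2) =
      fun x : U ↦ (kerrCylUnitNormal m a (kerrCylMap r₀ a τ₀ R (x : E3)) : E4) := by
    funext x
    rw [← hf x]
    exact (congrArg Prod.snd (OpensChart.trivializationAt_apply (f y) (f x)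
      (kerrCylUnitNormal m a (f x : E4)))).trans rfl
  rw [h]
  obtain ⟨hx, hq⟩ := radius_pos_and_bilin_radiusSharp_neg ha h₁ h₂ hU hf y
  rw [hf y] at hx hq
  exact (OpensChart.contMDiffAt_iff y _ (fun z : E3 ↦ kerrCylUnitNormal m a (kerrCylMap r₀ a τ₀ R z))
    (fun _ ↦ rfl)).mpr
    ((contDiffAt_kerrCylUnitNormal hx hq).comp (y : E3) (contDiffAt_kerrCylMap r₀ a τ₀ R (hU y)))

/-- **The second fundamental form of the Kerr cylinder frame depends only on the point**: for two
frames `f : U → Kerr.region a r₁`, `f' : U' → Kerr.region a r₁` with the same representative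
`kerrCylMap r₀ a τ₀ R` and the normals `kerrCylUnitNormal m a ∘ f`, `kerrCylUnitNormal m a ∘ f'`,
`K(f) y = K(f') y'` whenever `(y : E3) = y'` — both are the coordinate expression
`g(DN v + Γ(N)(DΦ v), DΦ w)` (`OpensChart.secondFundamentalForm_eq_of_repr`). [folklore] -/
theorem secondFundamentalForm_kerrCylOn_eq [Kerr.Facts] [(Kerr.smoothMetric m a r₁).HasLeviCivita]
    (ha : |a| < m) (h₁ : Kerr.rMinus m a < r₀) (h₂ : r₀ < Kerr.rPlus m a)
    (hU : ∀ y : U, (y : E3) ≠ 0) (hf : ∀ y, (f y : E4) = kerrCylMap r₀ a τ₀ R (y : E3))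
    {U' : Opens E3} {f' : U' → Kerr.region a r₁} (hU' : ∀ y : U', (y : E3) ≠ 0)
    (hf' : ∀ y, (f' y : E4) = kerrCylMap r₀ a τ₀ R (y : E3)) (y : U) (y' : U')
    (hyy' : (y : E3) = y') (v w : E3) :
    (Kerr.smoothMetric m a r₁).secondFundamentalForm 𝓘(ℝ, E3) f
        (fun z ↦ kerrCylUnitNormal m a (f z : E4)) y v w =
      (Kerr.smoothMetric m a r₁).secondFundamentalForm 𝓘(ℝ, E3) f'
        (fun z ↦ kerrCylUnitNormal m a (f' z : E4)) y' v w := by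
  obtain ⟨hx, hq⟩ := radius_pos_and_bilin_radiusSharp_neg ha h₁ h₂ hU hf y
  rw [hf y] at hx hq
  have hN : DifferentiableAt ℝ (fun z : E3 ↦ kerrCylUnitNormal m a (kerrCylMap r₀ a τ₀ R z)) y :=
    ((contDiffAt_kerrCylUnitNormal hx hq (n := 1)).comp (y : E3)
      (contDiffAt_kerrCylMap r₀ a τ₀ R (hU y))).differentiableAt one_ne_zero
  have hN' : DifferentiableAt ℝ (fun z : E3 ↦ kerrCylUnitNormal m a (kerrCylMap r₀ a τ₀ R z)) y' := by
    rwa [← hyy']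
  rw [OpensChart.secondFundamentalForm_eq_of_repr
      (g := (Kerr.smoothMetric m a r₁).toPseudoRiemannianMetric) (G := Kerr.bilin m a)
      (Kerr.smoothMetric_val m a r₁) hf (N := fun z : E3 ↦ kerrCylUnitNormal m a (kerrCylMap r₀ a τ₀ R z))
      (fun z ↦ by simp only [hf z]) (differentiableAt_kerrCylMap r₀ a τ₀ R (hU y)) hN
      (Kerr.differentiableAt_bilin m a _) v w,
    OpensChart.secondFundamentalForm_eq_of_repr
      (g := (Kerr.smoothMetric m a r₁).toPseudoRiemannianMetric) (G := Kerr.bilin m a)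
      (Kerr.smoothMetric_val m a r₁) hf' (N := fun z : E3 ↦ kerrCylUnitNormal m a (kerrCylMap r₀ a τ₀ R z))
      (fun z ↦ by simp only [hf' z]) (differentiableAt_kerrCylMap r₀ a τ₀ R (hU' y')) hN'
      (Kerr.differentiableAt_bilin m a _) v w]
  -- both sides are the same expression at the point `f y = f' y'` of the chart
  have hpt : f y = f' y' := Subtype.ext (by rw [hf y, hf' y', hyy'])
  rw [hpt, hyy']

end Frame

/-! ### Exact Kerr-cylinder data solve the vacuum constraints -/

/-- **Exact Kerr-cylinder data are vacuum** (Li–Mei Prop. 4.1, the Kerrian end of the conclusion):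
if a datum `D` on `E3` is exactly the Kerr(`m, a`)-cylinder datum `{r = r₀}` in standard form on an
OPEN set `s ⊆ {1 < ‖y‖}` — `LiMei.IsKerrCylinderOn m a r₀ τ₀ R s D`: `h = ψ^* g_{m,a}`, `k = K_ν(ψ)`
on `s` for the pinned frame `ψ = kerrCylMap r₀ a τ₀ R` and its future unit normal — with `|a| < m`,
`r₋(m, a) < r₀ < r₊(m, a)`, then `D` solves the vacuum constraint equations
`R(h) − |k|² + (tr k)² = 0`, `div k − d(tr k) = 0` at every point of `s` (`LiMei.IsVacuumOn s D`).
Gauss–Codazzi for the restriction of `D` to the open submanifold `s`, which is the datum induced by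
the spacelike immersion `kerrCylMap r₀ a τ₀ R : s → Kerr.region a r₁` with its future unit normal
(`ν` is the explicit `kerrCylUnitNormal` by uniqueness) into the Ricci-flat Kerr chart
(`Kerr.ricci_smoothMetric`): `InitialDataSet.isVacuumConstraintSolution_of_eq_induced`
(Choquet-Bruhat 2009, Ch. VI, Thm. 3.3), transported back to `D` by the naturality of the constraint
functions under the open inclusion (`hamiltonianConstraintFn_comap`, `momentumConstraintFn_comap_apply`,
Bartnik–Isenberg 2004, §2). Li–Mei arXiv:2005.01249, Prop. 4.1 (Kerr initial data are vacuum data).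
[cite: LiMei2020, Prop. 4.1] -/
theorem isVacuumOn_of_isKerrCylinderOn [Kerr.Facts] {m a r₀ τ₀ : ℝ} {R : E3 →ₗᵢ[ℝ] E3}
    {s : Set E3} (hs : IsOpen s) (hs1 : s ⊆ {y | 1 < ‖y‖}) (ha : |a| < m)
    (h₁ : Kerr.rMinus m a < r₀) (h₂ : r₀ < Kerr.rPlus m a) {D : InitialDataSet (𝓡 3) E3}
    (hK : IsKerrCylinderOn m a r₀ τ₀ R s D) : IsVacuumOn s D := by
  obtain ⟨r₁, hm, ψ, ν, -, hψ, -, hν, hh, hk⟩ := hK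
  intro instD y hy
  -- the open submanifold `s` and the frame on it
  set W : Opens E3 := ⟨s, hs⟩ with hW
  have hmem : ∀ {z : E3}, z ∈ s → z ∈ Kerr.slice 0 1 := fun hz ↦ by
    rw [Kerr.mem_slice_zero_iff, max_eq_left zero_le_one]; exact hs1 hz
  have hW0 : ∀ z : W, (z : E3) ≠ 0 := fun z ↦ ne_zero_of_mem_slice ⟨z, hmem z.2⟩
  have hS0 : ∀ z : Kerr.slice 0 1, (z : E3) ≠ 0 := fun z ↦ ne_zero_of_mem_slice z
  set f : W → Kerr.region a r₁ := fun z ↦ ψ ⟨z, hmem z.2⟩ with hf_def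
  have hf : ∀ z, (f z : E4) = kerrCylMap r₀ a τ₀ R (z : E3) := fun z ↦ hψ _
  haveI hg : (Kerr.smoothMetric m a r₁).HasLeviCivita := PseudoRiemannianMetric.hasLeviCivita _
  -- the abstract normal is the explicit one
  have hνrep : ∀ z : Kerr.slice 0 1, ν z = kerrCylUnitNormal m a (ψ z : E4) :=
    eq_kerrCylUnitNormal hm ha h₁ h₂ τ₀ R hψ hν
  -- the restricted datum
  set DW := D.comap (Subtype.val : W → E3) (InitialDataSet.contMDiff_subtypeVal_succ W)
    (InitialDataSet.injective_mfderiv_subtypeVal W) with hDW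
  haveI hDWi : DW.metric.HasLeviCivita := PseudoRiemannianMetric.hasLeviCivita _
  have hval : ∀ (z : W) (v : E3),
      mfderiv (𝓡 3) (𝓡 3) (Subtype.val : W → E3) z v = v := fun z v ↦ by
    rw [Literature.Geometry.Manifold.OpenSubmanifold.mfderiv_subtype_val]; rfl
  -- Gauss–Codazzi on `W`
  have hvac : DW.IsVacuumConstraintSolution := by
    refine InitialDataSet.isVacuumConstraintSolution_of_eq_induced
      ((Kerr.smoothMetric m a r₁).toPseudoRiemannianMetric) DW
      (isSpacelikeImmersion_kerrCylOn ha h₁ h₂ hW0 hf)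
      (isUnitNormal_kerrCylUnitNormalOn ha h₁ h₂ hW0 hf)
      (contMDiff_kerrCylUnitNormal_lift ha h₁ h₂ hW0 hf)
      (m := 3) finrank_euclideanSpace_fin finrank_euclideanSpace_fin
      (fun z ↦ Kerr.ricci_smoothMetric m a r₁ (f z)) (fun z v w ↦ ?_) (fun z v w ↦ ?_)
    · -- `h = ψ^* g` on `s`
      have hhz := hh ⟨z, hmem z.2⟩ z.2
      rw [hDW, InitialDataSet.comap_h_inner, hval, hval]
      show D.h.inner (z : E3) v w = _
      have e1 : D.h.inner (z : E3) v w = (Kerr.smoothMetric m a r₁).val (ψ ⟨z, hmem z.2⟩)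
          (mfderiv 𝓘(ℝ, E3) 𝓘(ℝ, E4) ψ ⟨z, hmem z.2⟩ v)
          (mfderiv 𝓘(ℝ, E3) 𝓘(ℝ, E4) ψ ⟨z, hmem z.2⟩ w) :=
        congrArg (fun B ↦ B v w) hhz
      rw [mfderiv_kerrCylOn_apply hS0 hψ, mfderiv_kerrCylOn_apply hS0 hψ] at e1
      rw [mfderiv_kerrCylOn_apply hW0 hf, mfderiv_kerrCylOn_apply hW0 hf]
      exact e1
    · -- `k = K_ν(ψ)` on `s`, and `K` of the restricted frame is `K` of `ψ`
      have hkz := hk ⟨z, hmem z.2⟩ z.2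
      rw [hDW, InitialDataSet.comap_k, hval, hval]
      show D.k (z : E3) v w = _
      have e1 : D.k (z : E3) v w = (Kerr.smoothMetric m a r₁).secondFundamentalForm 𝓘(ℝ, E3) ψ ν
          ⟨z, hmem z.2⟩ v w := by
        have := LinearMap.congr_fun₂ hkz v w
        exact this
      rw [e1, show ν = fun z ↦ kerrCylUnitNormal m a (ψ z : E4) from funext hνrep]
      exact secondFundamentalForm_kerrCylOn_eq ha h₁ h₂ hS0 hψ hW0 hf ⟨z, hmem z.2⟩ z rfl v w
  -- transport back to `D` along the open inclusion
  obtain ⟨hH, hM⟩ := hvac ⟨y, hy⟩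
  refine ⟨?_, ?_⟩
  · rw [← D.hamiltonianConstraintFn_comap (InitialDataSet.contMDiff_subtypeVal_succ W)
      (InitialDataSet.injective_mfderiv_subtypeVal W) rfl ⟨y, hy⟩]
    exact hH
  · refine LinearMap.ext fun v ↦ ?_
    have e := D.momentumConstraintFn_comap_apply (InitialDataSet.contMDiff_subtypeVal_succ W)
      (InitialDataSet.injective_mfderiv_subtypeVal W) rfl ⟨y, hy⟩ (D.mdifferentiableAt_traceK y) v
    rw [hval] at e
    rw [LinearMap.zero_apply, ← e, hM, LinearMap.zero_apply]

end LiMei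

end Literature.Geometry.Lorentzian

end
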